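import Summits.Langlands.Langlands.Theses.HolomorphicShadow

/-!
BC3 birth skeleton — child `PairCompatibilityAllData` of `HolomorphicShadow.SectorComplement` (stmt-Langlands-14623),
crux-strategist planner-cstrat-stmt-Langlands-14623-r1-0, 2026-08-17.  Named stubs (the ONLY sorries) and
`PairCompatibilityAllData_of : stubs → PairCompatibilityAllData` kernel-checked.  Context = the route file's (child restated verbatim from Sketch.lean /
children.json; after the split the `def` is deleted and the namespace line kept, cf. post/).
Cut: LGC∀ ⟸ LGC∃ (ONE pinned reciprocity datum per field compatible at every finite place with every irreducible a.e.-compatible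
pinned-geometric pair: Taylor 2004 Conj. 7 + the Harris–Taylor/Henniart datum; VERBATIM the sibling child `PairCompatibility` text =
registered stubs away/above of line `Sketch` on stmt-Langlands-14328) ∧ R (RIGIDITY OF PINNED DATA: any two `ReciprocityData K` have
the same `rec_n` on local components of cuspidal `π` — Henniart 1993 Thm. 1.1 in print; VERBATIM the hypothesis of
`langlands_iff_exists_of_rigid` of the LIVE line `reciprocity-rigidity` on stmt-Langlands-18745, whose stubs S1/S2 are landed and whose
hard stub S5 (generic non-supercuspidal classes, rank ≥ 2) is held by that line's lead).  Composition: `Nonempty` from `∃ Rec`;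
transport of `LocalGlobalCompatibleAt Rec → LocalGlobalCompatibleAt Rec'` along R (the `p`-adic Hodge datum is pinned, `rfl`).
-/

set_option linter.dupNamespace false

namespace Summit.Langlands.Langlands.Theses.HolomorphicShadow

open scoped BigOperators Topology Manifold Classical MeasureTheory ProbabilityTheory Matrix InnerProductSpace ComplexConjugate ContinuousMap
open Filter Set Function TopologicalSpace MeasureTheory

/-- Piece LGC∀ — reciprocity data exist and every pinned datum is compatible everywhere with every irreducible a.e.-compatible pinned-geometric pair (pre-split stand-in; byte-identical with children.json). -/
def PairCompatibilityAllData : Prop :=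
  ∀ (K : Type) [Field K] [NumberField K], Nonempty (ReciprocityData K) ∧ ∀ (Rec : ReciprocityData K) (n : ℕ) (hcpt : Literature.NumberTheory.Automorphic.isCompact_glFiniteIntegralLevel n K), 0 < n → ∀ (π : Literature.NumberTheory.Automorphic.CuspidalAutomorphicRepData n K hcpt), π.1.IsLAlgebraic → ∀ (ℓ : ℕ) [Fact ℓ.Prime] (ι : PadicAlgCl ℓ ≃+* ℂ) (ρ : Literature.NumberTheory.GaloisRepresentations.FramedGaloisRep K (PadicAlgCl ℓ) n), ρ.toGaloisRep.IsIrreducible → ((∀ᶠ v : IsDedekindDomain.HeightOneSpectrum (NumberField.RingOfIntegers K) in cofinite, ρ.IsUnramifiedAt v) ∧ ∀ (v : IsDedekindDomain.HeightOneSpectrum (NumberField.RingOfIntegers K)) (hv : ((ℓ : ℕ) : NumberField.RingOfIntegers K) ∈ v.asIdeal), (Literature.NumberTheory.PAdicHodge.fontainePstAdicCompletion v ℓ hv).IsDeRhamFramed (ρ.toLocal v)) → (∀ᶠ v : IsDedekindDomain.HeightOneSpectrum (NumberField.RingOfIntegers K) in cofinite, SatakeFrobCompatibleAt ι π.1 ρ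 v) → ∀ v : IsDedekindDomain.HeightOneSpectrum (NumberField.RingOfIntegers K), LocalGlobalCompatibleAt Rec ι π.1 ρ v


namespace Cruxes.PairCompatibilityAllData.Birth

/-- **stub LGC∃ (OPEN: Taylor 2004 Conj. 7 at every finite place for irreducible pairs, for ONE pinned datum per field; carries the
Harris–Taylor existence debt of `Rec`)** — verbatim the sibling child `PairCompatibility` (Cruxes/SectorToLanglands/Lines/
birth_PairCompatibility.lean cuts it further into away/above = the registered stubs of line `Sketch` on stmt-Langlands-14328).
[cite: TaylorGaloisRepresentations2004, Conj. 7] [cite: HarrisTaylorAMS2001, Thm. A] -/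
theorem stub_pairCompatibilityExists :
    ∀ (K : Type) [Field K] [NumberField K], ∃ Rec : ReciprocityData K, ∀ (n : ℕ) (hcpt : Literature.NumberTheory.Automorphic.isCompact_glFiniteIntegralLevel n K), 0 < n → ∀ (π : Literature.NumberTheory.Automorphic.CuspidalAutomorphicRepData n K hcpt), π.1.IsLAlgebraic → ∀ (ℓ : ℕ) [Fact ℓ.Prime] (ι : PadicAlgCl ℓ ≃+* ℂ) (ρ : Literature.NumberTheory.GaloisRepresentations.FramedGaloisRep K (PadicAlgCl ℓ) n), ρ.toGaloisRep.IsIrreducible → ((∀ᶠ v : IsDedekindDomain.HeightOneSpectrum (NumberField.RingOfIntegers K) in cofinite, ρ.IsUnramifiedAt v) ∧ ∀ (v : IsDedekindDomain.HeightOneSpectrum (NumberField.RingOfIntegers K)) (hv : ((ℓ : ℕ) : NumberField.RingOfIntegers K) ∈ v.asIdeal), (Literature.NumberTheory.PAdicHodge.fontainePstAdicCompletion v ℓ hv).IsDeRhamFramed (ρ.toLocal v)) → (∀ᶠ v : IsDedekindDomain.HeightOneSpectrum (NumberField.RingOfIntegers K) in cofinite, SatakeFrobCompatibleAt ι π.1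 ρ v) → ∀ v : IsDedekindDomain.HeightOneSpectrum (NumberField.RingOfIntegers K), LocalGlobalCompatibleAt Rec ι π.1 ρ v := by
  sorry

/-- **stub R — rigidity of pinned reciprocity data on local components of cuspidal representations** (Henniart 1993, Thm. 1.1: the
`IsLocalLanglandsGL` clauses with the PINNED Artin maps / `ε`-systems characterise `rec_n`; ranks 0/1 and supercuspidal classes are in
reach of the tree — `rec_one_eq_recGLOne`, `artin_eq`, the named fact `localLanglands_gl` —, generic non-supercuspidal classes of rank ≥ 2
are the hard stub S5 of the live line `reciprocity-rigidity` on stmt-Langlands-18745).  Why it might fail AS TYPED: if `IsLocalLanglandsGL`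
under-determines `rec` on generic non-supercuspidal classes, two legal data differ there — the summit's own `∀ 𝓡` exposure, no more.
[cite: Henniarts1993, Thm 1.1] [cite: HarrisTaylorAMS2001, Thm. A] -/
theorem stub_reciprocityRigidity :
    ∀ (K : Type) [Field K] [NumberField K] (Rec Rec' : ReciprocityData K) (n : ℕ) (hcpt : Literature.NumberTheory.Automorphic.isCompact_glFiniteIntegralLevel n K), 0 < n → ∀ (π : Literature.NumberTheory.Automorphic.CuspidalAutomorphicRepData n K hcpt) (v : IsDedekindDomain.HeightOneSpectrum (NumberField.RingOfIntegers K)) (πv : Literature.NumberTheory.Automorphic.SmoothIrrep (GL (Fin n) (v.adicCompletion K))), π.1.HasLocalComponentAt v πv.ρ → (Rec.llc v).recGL n (Literature.NumberTheory.Automorphic.IrrClass.mk πv) = (Rec'.llc v).recGL n (Literature.NumberTheory.Automorphic.IrrClass.mk πv) := by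
  sorry

/-- **LGC∀ from LGC∃ and R**: non-vacuity from the datum of LGC∃; for any other pinned datum `Rec'`, transport the local–global
compatibility clause along R (`ReciprocityData.pst` is the pinned Fontaine datum, independent of the datum by `rfl`). -/
theorem PairCompatibilityAllData_of
    (hE : ∀ (K : Type) [Field K] [NumberField K], ∃ Rec : ReciprocityData K, ∀ (n : ℕ) (hcpt : Literature.NumberTheory.Automorphic.isCompact_glFiniteIntegralLevel n K), 0 < n → ∀ (π : Literature.NumberTheory.Automorphic.CuspidalAutomorphicRepData n K hcpt), π.1.IsLAlgebraic → ∀ (ℓ : ℕ) [Fact ℓ.Prime] (ι : PadicAlgCl ℓ ≃+* ℂ) (ρ : Literature.NumberTheory.GaloisRepresentations.FramedGaloisRep K (PadicAlgCl ℓ) n), ρ.toGaloisRep.IsIrreducible → ((∀ᶠ v : IsDedekindDomain.HeightOneSpectrum (NumberField.RingOfIntegers K) in cofinite, ρ.IsUnramifiedAt v) ∧ ∀ (v : IsDedekindDomain.HeightOneSpectrum (NumberField.RingOfIntegers K)) (hv : ((ℓ : ℕ) : NumberField.RingOfIntegers K) ∈ v.asIdeal), (Literature.NumberTheory.PAdicHodge.fontainePstAdicCompletion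 v ℓ hv).IsDeRhamFramed (ρ.toLocal v)) → (∀ᶠ v : IsDedekindDomain.HeightOneSpectrum (NumberField.RingOfIntegers K) in cofinite, SatakeFrobCompatibleAt ι π.1 ρ v) → ∀ v : IsDedekindDomain.HeightOneSpectrum (NumberField.RingOfIntegers K), LocalGlobalCompatibleAt Rec ι π.1 ρ v)
    (hR : ∀ (K : Type) [Field K] [NumberField K] (Rec Rec' : ReciprocityData K) (n : ℕ) (hcpt : Literature.NumberTheory.Automorphic.isCompact_glFiniteIntegralLevel n K), 0 < n → ∀ (π : Literature.NumberTheory.Automorphic.CuspidalAutomorphicRepData n K hcpt) (v : IsDedekindDomain.HeightOneSpectrum (NumberField.RingOfIntegers K)) (πv : Literature.NumberTheory.Automorphic.SmoothIrrep (GL (Fin n) (v.adicCompletion K))), π.1.HasLocalComponentAt v πv.ρ → (Rec.llc v).recGL n (Literature.NumberTheory.Automorphic.IrrClass.mk πv) = (Rec'.llc v).recGL n (Literature.NumberTheory.Automorphic.IrrClass.mk πv)) :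
    PairCompatibilityAllData := by
  intro K _ _
  obtain ⟨Rec, hRec⟩ := hE K
  refine ⟨⟨Rec⟩, fun Rec' n hcpt hn π hL ℓ _ ι ρ hirr hgeo hρ v => ?_⟩
  obtain ⟨πv, r, rℂ, hπv, hlad, hpst, htr, hcls⟩ := hRec n hcpt hn π hL ℓ ι ρ hirr hgeo hρ v
  refine ⟨πv, r, rℂ, hπv, hlad, hpst, htr, ?_⟩
  rw [← hR K Rec Rec' n hcpt hn π v πv hπv]
  exact hcls

/-- The composition with the stubs plugged in: `PairCompatibilityAllData` modulo exactly {LGC∃, R}. -/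
theorem PairCompatibilityAllData_of_stubs : PairCompatibilityAllData :=
  PairCompatibilityAllData_of stub_pairCompatibilityExists stub_reciprocityRigidity

end Cruxes.PairCompatibilityAllData.Birth

end Summit.Langlands.Langlands.Theses.HolomorphicShadow
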